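import Literature.AnabelianGeometry.SemiGraphs.ProSigmaClosedSurfaceElastic
import Literature.AnabelianGeometry.AbsoluteAnabelian.ProfiniteSlimAscent
import HarnessLib

/-!
# [AbsTopI] Prop 2.3 (i) at the ALMOST pro-`Σ` surface-group model (closed class)

S. Mochizuki, *Topics in Absolute Anabelian Geometry I: Generalities* (2012) [AbsTopI] (lit key
`paper:url-11ac98ba15fc`), Prop 2.3 (i) p. 19: "Let `Δ` be a profinite group of GFG-type that admits partial
construction data `(k, X, Σ)` … such that `X` is a hyperbolic orbicurve, and `Σ` contains a prime invertible in `k`.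
Then `Δ` is slim and elastic."  By Def 2.1 (i) p. 17 a GFG-type group is "almost pro-`Σ`": for construction data
`(k, X, Y ↪ Ȳ, Σ)` with a finite étale Galois covering `Y → X`, `Δ_X` is the quotient of
`Ker(π₁^tame(X_k̄) ↠ Gal(Y/X))` … — an extension of the FINITE group `Gal(Y/X)` by the (maximal pro-`Σ` quotient of
the) fundamental group of `Y`, which sits in `Δ_X` as an OPEN subgroup.

The tree proves Prop 2.3 (i) at the PRO-`Σ` surface-group model (`Y = X`): abc-iut-L4-d1
`slim_and_elastic_of_isProSigmaCompletion_closedSurfaceGroup` (closed class, `SemiGraphs/ProSigmaClosedSurfaceElastic.lean`),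
abc-iut-w5-d206 (punctured class).  This PROOF-ONLY file (no definition, no named fact) lifts the closed class to the
ALMOST pro-`Σ` model by pure group theory — the two ascent theorems of abc-iut-w6-d071
(`isElastic_of_isSlimGroup_of_isOpen_of_isElastic`, `ProfiniteElasticAscent.lean`;
`isSlimGroup_of_isOpen_slim_of_forall_finite_normal_eq_bot`, `ProfiniteSlimAscent.lean`):

* `slim_and_elastic_of_isOpen_proSigma_closedSurfaceGroup` — a compact Hausdorff totally disconnected group `G`
  with NO nontrivial finite normal subgroup, containing an OPEN subgroup `U` that is a pro-`Σ` completion of a closed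
  surface group `Γ_{g,0}` (`g ≥ 2`, `Σ` a nonempty set of primes), is slim and elastic;
* `FundamentalExtension.geomSlimElastic_of_isOpen_proSigma_closedSurfaceGroup` — the typed node predicate
  `E.GeomSlimElastic` for every extension whose `Δ` is such a `G`.

HONEST SCOPE: the hypothesis «no nontrivial finite normal subgroup of `Δ`» is NECESSARY for the ascent (a product
`Δ' × F` with `F` finite is not slim) and is a genuinely geometric input for `Δ_X` (it holds for the geometric
fundamental group of a hyperbolic orbicurve, being itself slim — which is what print asserts); so this file REDUCES
print's almost pro-`Σ` case to that single input, it does not discharge it.  Punctured class (`r ≥ 1`) = the same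
two lines over abc-iut-w5-d206's `slim_and_elastic_of_isProSigmaCompletion_puncturedSurfaceGroup` once its module has an
olean (OPS 07:53:39Z); orbicurves / `char k ∈ Σ` stay outside the model (see `AbsTopIProp23iHyperbolicModelProofs`).
Classical; OUR kernel check; nothing here bears on [IUTchIII] Cor. 3.12.
-/

noncomputable section

open Topology

universe u

namespace Literature.AnabelianGeometry.AbsoluteAnabelian

open Literature.AlgebraicGeometry.Frobenioids (IsSlimGroup)
open Literature.AnabelianGeometry.SemiGraphs.SemiGraphOfAnabelioids
open Literature.GroupTheory.CombinatorialGroupTheory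

variable {G : Type u} [Group G] [TopologicalSpace G] [IsTopologicalGroup G] [CompactSpace G] [T2Space G]
  [TotallyDisconnectedSpace G]

/-- **Prop 2.3 (i), almost pro-`Σ` closed-surface model**: if `G` is profinite with no nontrivial finite normal
subgroup and an OPEN subgroup `U ⊆ G` is a pro-`Σ` completion of `Γ_{g,0}` (`g ≥ 2`, `Σ` a nonempty set of
primes), then `G` is slim and elastic (model: `U` slim ∧ elastic; ascent: `ProfiniteSlimAscent`,
`ProfiniteElasticAscent`). [cite: MochizukiAbsTopI2012, Prop 2.3 (i) p.19] -/
theorem slim_and_elastic_of_isOpen_proSigma_closedSurfaceGroup {Sigma : Set ℕ} (hS : Sigma.Nonempty)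
    (hSp : ∀ p ∈ Sigma, p.Prime) {g : ℕ} (hg : 2 ≤ g) (U : Subgroup G) (hUo : IsOpen (U : Set G))
    (ι : PuncturedSurfaceGroup g 0 →* U) (hι : IsProSigmaCompletion Sigma ι)
    (hfin : ∀ N : Subgroup G, N.Normal → (N : Set G).Finite → N = ⊥) : IsSlimGroup G ∧ IsElastic G := by
  haveI : CompactSpace U := isCompact_iff_compactSpace.mp (Subgroup.isClosed_of_isOpen U hUo).isCompact
  have hU := IsProSigmaCompletion.slim_and_elastic_of_isProSigmaCompletion_closedSurfaceGroup Sigma hS hSp g hg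
    U ι hι
  exact slim_and_elastic_of_isOpen U hUo hU.1 hU.2 hfin

namespace FundamentalExtension

/-- **F-0239 `GeomSlimElastic` at the almost pro-`Σ` closed-surface model**: for an extension `1 → Δ → Π → G → 1`
whose `Δ` has no nontrivial finite normal subgroup and contains an OPEN subgroup presented as a pro-`Σ` completion
`ι : Γ_{g,0} → U` (`g ≥ 2`, `Σ` a nonempty set of primes) — the shape of a GFG-type group with construction data
`(k, X, Y ↪ Ȳ, Σ)`, `Y → X` finite étale Galois, `Y` proper of genus `g` — the typed predicate `E.GeomSlimElastic`
holds. [cite: MochizukiAbsTopI2012, Prop 2.3 (i) p.19] -/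
theorem geomSlimElastic_of_isOpen_proSigma_closedSurfaceGroup (E : FundamentalExtension.{u}) {Sigma : Set ℕ}
    (hS : Sigma.Nonempty) (hSp : ∀ p ∈ Sigma, p.Prime) {g : ℕ} (hg : 2 ≤ g) (U : Subgroup E.geom)
    (hUo : IsOpen (U : Set E.geom)) (ι : PuncturedSurfaceGroup g 0 →* U) (hι : IsProSigmaCompletion Sigma ι)
    (hfin : ∀ N : Subgroup E.geom, N.Normal → (N : Set E.geom).Finite → N = ⊥) : E.GeomSlimElastic := by
  haveI : CompactSpace E.geom := isCompact_iff_compactSpace.mp E.isClosed_geom.isCompact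
  exact slim_and_elastic_of_isOpen_proSigma_closedSurfaceGroup hS hSp hg U hUo ι hι hfin

/-- The case `U = ⊤` recovers the pro-`Σ` model of record (consistency check: for the trivial covering `Y = X`
the extra hypothesis is redundant — it follows from the slimness the model proves — but the packaged statement
asks for it uniformly). [cite: MochizukiAbsTopI2012, Prop 2.3 (i) p.19] -/
theorem geomSlimElastic_of_isOpen_proSigma_closedSurfaceGroup_top (E : FundamentalExtension.{u})
    {Sigma : Set ℕ} (hS : Sigma.Nonempty) (hSp : ∀ p ∈ Sigma, p.Prime) {g : ℕ} (hg : 2 ≤ g)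
    (ι : PuncturedSurfaceGroup g 0 →* (⊤ : Subgroup E.geom)) (hι : IsProSigmaCompletion Sigma ι)
    (hfin : ∀ N : Subgroup E.geom, N.Normal → (N : Set E.geom).Finite → N = ⊥) : E.GeomSlimElastic :=
  E.geomSlimElastic_of_isOpen_proSigma_closedSurfaceGroup hS hSp hg ⊤ isOpen_univ ι hι hfin

end FundamentalExtension

end Literature.AnabelianGeometry.AbsoluteAnabelian

end
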